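import Summits.NavierStokesRegularity.NavierStokesRegularity.Theorems.RellichScarScarRigidityApexRegularityKernel
import HarnessLib

/-!
# `ScarRigidity`, line `moment-conditioned-rellich` — stub `stub_biotSavartFarField` (BS), part 1:
# bounded smooth kernels against integrable densities, all orders; the far Newton kernel at scale `c`

Crux stmt-NavierStokesRegularity-11717 (route RellichScar), helper file (`--supports`) for the registered stub
`stub_biotSavartFarField` (skeleton `Cruxes/ScarRigidity/Lines/moment_conditioned_rellich.lean`).

The far field of `∂^α w = Γ ⋆ ∂^α Δw` at a point `x₀` is computed after splitting the Newton kernel at the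
scale `c = ‖x₀‖/4`: `Γ = Γ₀^{c,2c} + Γ∞^{c,2c}`.  This file supplies the kernel-side calculus of the smooth
far piece:

* `hasFDerivAt_integral_boundedKernel_smul`, `iteratedFDeriv_integral_boundedKernel_smul_apply` — for a smooth
  scalar kernel `Φ` all of whose derivatives are bounded and a continuous integrable density `F`,
  `x ↦ ∫ Φ(x − y) • F(y) dy` is smooth and `Dⁿ(∫ Φ(· − y) • F(y) dy)(x) m = ∫ (DⁿΦ(x − y) m) • F(y) dy`
  (dominated differentiation, iterated through directional derivatives as in
  `…ApexRegularityKernel.iteratedFDeriv_integral_clm_apply_comp_sub_decay_apply`);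
* `norm_iteratedFDeriv_iteratedFDeriv_apply_le` — `‖Dʲ(z ↦ DᵏΦ(z) m)‖ ≤ (∏‖mᵢ‖) ‖Dʲ⁺ᵏΦ‖`;
* `exists_norm_iteratedFDeriv_newtonFar_le`, `norm_iteratedFDeriv_newtonFar_scale_le` — every derivative of
  `Γ∞^{1,2}` is bounded, and `‖DⁿΓ∞^{c,2c}(z)‖ ≤ c^{-(n+1)} sup ‖DⁿΓ∞^{1,2}‖` (scaling).
-/

noncomputable section

open Set Filter Function MeasureTheory Metric TopologicalSpace
open scoped Topology ContDiff

set_option linter.dupNamespace false -- D-0017: `Summit.<S>.<S>.…` repeats the summit name by design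

-- nested operator types (`ℝ³ [×n]→L[ℝ] ℝ` applied under `fderiv`)
set_option maxSynthPendingDepth 4

namespace Summit.NavierStokesRegularity.NavierStokesRegularity.Theorems.RellichScarScarRigidity

open Literature.Analysis.FluidPDE

variable {V : Type*} [NormedAddCommGroup V] [NormedSpace ℝ V]

/-! ### Bounded `C¹` kernels against integrable densities -/

/-- Continuity of `y ↦ (L y).smulRight (v y)` for continuous `L : X → ℝ³ →L[ℝ] ℝ` and `v : X → V`. [folklore] -/
theorem continuous_smulRight_comp' {X : Type*} [TopologicalSpace X]
    {L : X → EuclideanSpace ℝ (Fin 3) →L[ℝ] ℝ} {v : X → V} (hL : Continuous L) (hv : Continuous v) :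
    Continuous fun y => (L y).smulRight (v y) :=
  (ContinuousLinearMap.smulRightL ℝ (EuclideanSpace ℝ (Fin 3)) V).continuous₂.comp (hL.prodMk hv)

/-- **Differentiation under the integral sign, bounded kernel.** For a scalar kernel `Φ ∈ C¹(ℝ³)` with
`‖Φ‖ ≤ B₀`, `‖DΦ‖ ≤ B₁` and a continuous integrable density `F`: `y ↦ Φ(x − y) • F(y)` is integrable and
`x ↦ ∫ Φ(x − y) • F(y) dy` has the Fréchet derivative `∫ DΦ(x − y) ⊗ F(y) dy` (dominant `B₁‖F‖`). [folklore] -/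
theorem hasFDerivAt_integral_boundedKernel_smul {Φ : EuclideanSpace ℝ (Fin 3) → ℝ} (hΦ : ContDiff ℝ 1 Φ)
    {B₀ B₁ : ℝ} (hB₀ : ∀ z, ‖Φ z‖ ≤ B₀) (hB₁ : ∀ z, ‖fderiv ℝ Φ z‖ ≤ B₁)
    {F : EuclideanSpace ℝ (Fin 3) → V} (hFc : Continuous F) (hFi : Integrable F volume)
    (x : EuclideanSpace ℝ (Fin 3)) :
    Integrable (fun y => Φ (x - y) • F y) volume ∧
    HasFDerivAt (fun x => ∫ y, Φ (x - y) • F y) (∫ y, (fderiv ℝ Φ (x - y)).smulRight (F y)) x := by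
  have hΦc : Continuous Φ := hΦ.continuous
  have hdΦ : Continuous (fderiv ℝ Φ) := hΦ.continuous_fderiv one_ne_zero
  have hint : ∀ x', Integrable (fun y => Φ (x' - y) • F y) volume := fun x' =>
    (hFi.norm.const_mul B₀).mono'
      ((hΦc.comp (continuous_const.sub continuous_id)).smul hFc).aestronglyMeasurable
      (Eventually.of_forall fun y => by
        rw [norm_smul]
        exact mul_le_mul_of_nonneg_right (hB₀ _) (norm_nonneg _))
  have hF'm : ∀ x', AEStronglyMeasurable (fun y => (fderiv ℝ Φ (x' - y)).smulRight (F y)) volume :=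
    fun x' => (continuous_smulRight_comp' (hdΦ.comp (continuous_const.sub continuous_id))
      hFc).aestronglyMeasurable
  refine ⟨hint x, ?_⟩
  refine hasFDerivAt_integral_of_dominated_of_fderiv_le (F := fun x' y => Φ (x' - y) • F y)
    (F' := fun x' y => (fderiv ℝ Φ (x' - y)).smulRight (F y)) (bound := fun y => B₁ * ‖F y‖)
    (ball_mem_nhds x one_pos) (Eventually.of_forall fun x' =>
      ((hΦc.comp (continuous_const.sub continuous_id)).smul hFc).aestronglyMeasurable)
    (hint x) (hF'm x) ?_ (hFi.norm.const_mul B₁) ?_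
  · refine Eventually.of_forall fun y x' _ => ?_
    rw [ContinuousLinearMap.norm_smulRight_apply]
    exact mul_le_mul_of_nonneg_right (hB₁ _) (norm_nonneg _)
  · refine Eventually.of_forall fun y x' _ => ?_
    have h1 : HasFDerivAt (fun x' => Φ (x' - y)) (fderiv ℝ Φ (x' - y)) x' := by
      have := ((hΦ.differentiable one_ne_zero) (x' - y)).hasFDerivAt.comp x' (hasFDerivAt_sub_const y)
      rwa [ContinuousLinearMap.comp_id] at this
    exact h1.smul_const (F y)

/-- The directional derivative formula `∂ₐ ∫ Φ(x − y) • F(y) dy = ∫ (DΦ(x − y) a) • F(y) dy`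
(bounded `C¹` kernel, continuous integrable density). [folklore] -/
theorem fderiv_integral_boundedKernel_smul_apply [CompleteSpace V] {Φ : EuclideanSpace ℝ (Fin 3) → ℝ}
    (hΦ : ContDiff ℝ 1 Φ) {B₀ B₁ : ℝ} (hB₀ : ∀ z, ‖Φ z‖ ≤ B₀) (hB₁ : ∀ z, ‖fderiv ℝ Φ z‖ ≤ B₁)
    {F : EuclideanSpace ℝ (Fin 3) → V} (hFc : Continuous F) (hFi : Integrable F volume)
    (x a : EuclideanSpace ℝ (Fin 3)) :
    fderiv ℝ (fun x => ∫ y, Φ (x - y) • F y) x a = ∫ y, (fderiv ℝ Φ (x - y) a) • F y := by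
  rw [(hasFDerivAt_integral_boundedKernel_smul hΦ hB₀ hB₁ hFc hFi x).2.fderiv,
    ContinuousLinearMap.integral_apply]
  · rfl
  · refine (hFi.norm.const_mul B₁).mono'
      (continuous_smulRight_comp' ((hΦ.continuous_fderiv one_ne_zero).comp
        (continuous_const.sub continuous_id)) hFc).aestronglyMeasurable
      (Eventually.of_forall fun y => ?_)
    rw [ContinuousLinearMap.norm_smulRight_apply]
    exact mul_le_mul_of_nonneg_right (hB₁ _) (norm_nonneg _)

/-! ### Smooth kernels with bounded derivatives: all orders -/

/-- A global bound on `DᵏΦ` yields one on `Dᵏ(z ↦ DΦ(z) a)`: `‖Dᵏ(DΦ(·)a)‖ ≤ ‖a‖ sup‖Dᵏ⁺¹Φ‖`. [folklore] -/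
theorem forall_bound_iteratedFDeriv_fderiv_apply {Φ : EuclideanSpace ℝ (Fin 3) → ℝ} (hΦ : ContDiff ℝ ∞ Φ)
    (hB : ∀ k : ℕ, ∃ B, ∀ z, ‖iteratedFDeriv ℝ k Φ z‖ ≤ B) (a : EuclideanSpace ℝ (Fin 3)) :
    ∀ k : ℕ, ∃ B, ∀ z, ‖iteratedFDeriv ℝ k (fun w => fderiv ℝ Φ w a) z‖ ≤ B := by
  intro k
  obtain ⟨B, hBk⟩ := hB (k + 1)
  refine ⟨‖a‖ * B, fun z => ?_⟩
  have hΦk : ContDiff ℝ (k + 1 : ℕ) Φ := hΦ.of_le (by exact_mod_cast le_top)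
  calc ‖iteratedFDeriv ℝ k (fun w => fderiv ℝ Φ w a) z‖ ≤ ‖a‖ * ‖iteratedFDeriv ℝ (k + 1) Φ z‖ :=
        norm_iteratedFDeriv_fderiv_apply_le_of_contDiff hΦk a le_rfl z
    _ ≤ ‖a‖ * B := mul_le_mul_of_nonneg_left (hBk z) (norm_nonneg _)

/-- **Smoothness of `x ↦ ∫ Φ(x − y) • F(y) dy`** at every finite order, for a smooth scalar kernel with all
derivatives bounded and a continuous integrable density (induction on the order through the directional
derivatives `∂ₐ ∫ Φ(x − y) • F(y) dy = ∫ (∂ₐΦ)(x − y) • F(y) dy`). [folklore] -/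
theorem contDiff_integral_boundedKernel_smul [CompleteSpace V] :
    ∀ (n : ℕ) {Φ : EuclideanSpace ℝ (Fin 3) → ℝ}, ContDiff ℝ ∞ Φ →
      (∀ k : ℕ, ∃ B, ∀ z, ‖iteratedFDeriv ℝ k Φ z‖ ≤ B) →
      ∀ {F : EuclideanSpace ℝ (Fin 3) → V}, Continuous F → Integrable F volume →
      ContDiff ℝ n (fun x => ∫ y, Φ (x - y) • F y) := by
  intro n
  induction n with
  | zero =>
    intro Φ hΦ hB F hFc hFi
    obtain ⟨B₀, hB₀⟩ := hB 0
    obtain ⟨B₁, hB₁⟩ := hB 1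
    have h0 : ∀ z, ‖Φ z‖ ≤ B₀ := fun z => by rw [← norm_iteratedFDeriv_zero (𝕜 := ℝ)]; exact hB₀ z
    have h1 : ∀ z, ‖fderiv ℝ Φ z‖ ≤ B₁ := fun z => by rw [← norm_iteratedFDeriv_one]; exact hB₁ z
    have hΦ1 : ContDiff ℝ 1 Φ := hΦ.of_le (by exact_mod_cast le_top)
    exact contDiff_zero.2 (continuous_iff_continuousAt.2 fun x =>
      (hasFDerivAt_integral_boundedKernel_smul hΦ1 h0 h1 hFc hFi x).2.continuousAt)
  | succ n ih =>
    intro Φ hΦ hB F hFc hFi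
    obtain ⟨B₀, hB₀⟩ := hB 0
    obtain ⟨B₁, hB₁⟩ := hB 1
    have h0 : ∀ z, ‖Φ z‖ ≤ B₀ := fun z => by rw [← norm_iteratedFDeriv_zero (𝕜 := ℝ)]; exact hB₀ z
    have h1 : ∀ z, ‖fderiv ℝ Φ z‖ ≤ B₁ := fun z => by rw [← norm_iteratedFDeriv_one]; exact hB₁ z
    have hΦ1 : ContDiff ℝ 1 Φ := hΦ.of_le (by exact_mod_cast le_top)
    rw [show ((n + 1 : ℕ) : WithTop ℕ∞) = (n : WithTop ℕ∞) + 1 by push_cast; rfl,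
      contDiff_succ_iff_fderiv_apply]
    refine ⟨fun x => (hasFDerivAt_integral_boundedKernel_smul hΦ1 h0 h1 hFc hFi x).2.differentiableAt,
      fun h => absurd h (by exact_mod_cast WithTop.natCast_ne_top n), fun a => ?_⟩
    have hΦa : ContDiff ℝ ∞ fun w => fderiv ℝ Φ w a :=
      (hΦ.fderiv_right (m := ∞) le_rfl).clm_apply contDiff_const
    have heq : (fun x => fderiv ℝ (fun x => ∫ y, Φ (x - y) • F y) x a) =
        fun x => ∫ y, (fun w => fderiv ℝ Φ w a) (x - y) • F y :=
      funext fun x => fderiv_integral_boundedKernel_smul_apply hΦ1 h0 h1 hFc hFi x a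
    rw [heq]
    exact ih hΦa (forall_bound_iteratedFDeriv_fderiv_apply hΦ hB a) hFc hFi

/-- **All-orders differentiation under the integral sign, bounded smooth kernel**:
`Dⁿ(∫ Φ(· − y) • F(y) dy)(x) m = ∫ (DⁿΦ(x − y) m) • F(y) dy`. [folklore] -/
theorem iteratedFDeriv_integral_boundedKernel_smul_apply [CompleteSpace V] :
    ∀ (n : ℕ) {Φ : EuclideanSpace ℝ (Fin 3) → ℝ}, ContDiff ℝ ∞ Φ →
      (∀ k : ℕ, ∃ B, ∀ z, ‖iteratedFDeriv ℝ k Φ z‖ ≤ B) →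
      ∀ {F : EuclideanSpace ℝ (Fin 3) → V}, Continuous F → Integrable F volume →
      ∀ (x : EuclideanSpace ℝ (Fin 3)) (m : Fin n → EuclideanSpace ℝ (Fin 3)),
        iteratedFDeriv ℝ n (fun x => ∫ y, Φ (x - y) • F y) x m =
          ∫ y, (iteratedFDeriv ℝ n Φ (x - y) m) • F y := by
  intro n
  induction n with
  | zero =>
    intro Φ hΦ hB F hFc hFi x m
    simp only [iteratedFDeriv_zero_apply]
  | succ n ih =>
    intro Φ hΦ hB F hFc hFi x m
    obtain ⟨B₀, hB₀⟩ := hB 0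
    obtain ⟨B₁, hB₁⟩ := hB 1
    have h0 : ∀ z, ‖Φ z‖ ≤ B₀ := fun z => by rw [← norm_iteratedFDeriv_zero (𝕜 := ℝ)]; exact hB₀ z
    have h1 : ∀ z, ‖fderiv ℝ Φ z‖ ≤ B₁ := fun z => by rw [← norm_iteratedFDeriv_one]; exact hB₁ z
    have hΦ1 : ContDiff ℝ 1 Φ := hΦ.of_le (by exact_mod_cast le_top)
    have hI : ContDiff ℝ (n + 1 : ℕ) (fun x => ∫ y, Φ (x - y) • F y) :=
      contDiff_integral_boundedKernel_smul (n + 1) hΦ hB hFc hFi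
    have hDI : ContDiff ℝ n (fderiv ℝ fun x => ∫ y, Φ (x - y) • F y) :=
      hI.fderiv_right (by push_cast; exact le_rfl)
    set a := m (Fin.last n) with ha
    have hΦa : ContDiff ℝ ∞ fun w => fderiv ℝ Φ w a :=
      (hΦ.fderiv_right (m := ∞) le_rfl).clm_apply contDiff_const
    rw [iteratedFDeriv_succ_apply_right, ← iteratedFDeriv_clm_apply_const_apply hDI le_rfl]
    have heq : (fun x => fderiv ℝ (fun x => ∫ y, Φ (x - y) • F y) x a) =
        fun x => ∫ y, (fun w => fderiv ℝ Φ w a) (x - y) • F y :=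
      funext fun x => fderiv_integral_boundedKernel_smul_apply hΦ1 h0 h1 hFc hFi x a
    rw [heq, ih hΦa (forall_bound_iteratedFDeriv_fderiv_apply hΦ hB a) hFc hFi x (Fin.init m)]
    refine integral_congr_ae (Eventually.of_forall fun y => ?_)
    simp only
    rw [iteratedFDeriv_succ_apply_right, ← ha, iteratedFDeriv_clm_apply_const_apply
      ((hΦ.of_le (by exact_mod_cast le_top) : ContDiff ℝ (n + 1 : ℕ) Φ).fderiv_right
        (by push_cast; exact le_rfl)) le_rfl]

/-! ### Directional iterated derivatives -/

/-- **`‖Dʲ(z ↦ DᵏΦ(z) m)(z₀)‖ ≤ (∏ᵢ ‖mᵢ‖) ‖Dʲ⁺ᵏΦ(z₀)‖`** for smooth `Φ` (induction on `k` through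
`Dᵏ⁺¹Φ(z) m = Dᵏ(∂_{m_k}Φ)(z)(m₀, …, m_{k-1})`). [folklore] -/
theorem norm_iteratedFDeriv_iteratedFDeriv_apply_le {W : Type*} [NormedAddCommGroup W] [NormedSpace ℝ W] :
    ∀ (k : ℕ) {Φ : EuclideanSpace ℝ (Fin 3) → W}, ContDiff ℝ ∞ Φ →
      ∀ (j : ℕ) (m : Fin k → EuclideanSpace ℝ (Fin 3)) (z : EuclideanSpace ℝ (Fin 3)),
        ‖iteratedFDeriv ℝ j (fun w => iteratedFDeriv ℝ k Φ w m) z‖ ≤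
          (∏ i, ‖m i‖) * ‖iteratedFDeriv ℝ (j + k) Φ z‖ := by
  intro k
  induction k with
  | zero =>
    intro Φ hΦ j m z
    have e : (fun w => iteratedFDeriv ℝ 0 Φ w m) = Φ := funext fun w => iteratedFDeriv_zero_apply m
    rw [e, Finset.univ_eq_empty, Finset.prod_empty, one_mul, Nat.add_zero]
  | succ k ih =>
    intro Φ hΦ j m z
    show ‖iteratedFDeriv ℝ j (fun w => iteratedFDeriv ℝ (k + 1) Φ w m) z‖ ≤
      (∏ i, ‖m i‖) * ‖iteratedFDeriv ℝ (j + k + 1) Φ z‖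
    set a := m (Fin.last k) with ha
    have hΦa : ContDiff ℝ ∞ fun w => fderiv ℝ Φ w a :=
      (hΦ.fderiv_right (m := ∞) le_rfl).clm_apply contDiff_const
    have e : (fun w => iteratedFDeriv ℝ (k + 1) Φ w m) =
        fun w => iteratedFDeriv ℝ k (fun y => fderiv ℝ Φ y a) w (Fin.init m) := by
      funext w
      rw [iteratedFDeriv_succ_apply_right, ← ha, iteratedFDeriv_clm_apply_const_apply
        ((hΦ.of_le (by exact_mod_cast le_top) : ContDiff ℝ (k + 1 : ℕ) Φ).fderiv_right
          (by push_cast; exact le_rfl)) le_rfl]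
    rw [e]
    have hk : ContDiff ℝ (j + k + 1 : ℕ) Φ := hΦ.of_le (by exact_mod_cast le_top)
    calc ‖iteratedFDeriv ℝ j (fun w => iteratedFDeriv ℝ k (fun y => fderiv ℝ Φ y a) w (Fin.init m)) z‖
        ≤ (∏ i, ‖Fin.init m i‖) * ‖iteratedFDeriv ℝ (j + k) (fun y => fderiv ℝ Φ y a) z‖ :=
          ih hΦa j (Fin.init m) z
      _ ≤ (∏ i, ‖Fin.init m i‖) * (‖a‖ * ‖iteratedFDeriv ℝ (j + k + 1) Φ z‖) :=
          mul_le_mul_of_nonneg_left (norm_iteratedFDeriv_fderiv_apply_le_of_contDiff hk a le_rfl z)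
            (Finset.prod_nonneg fun i _ => norm_nonneg _)
      _ = (∏ i, ‖m i‖) * ‖iteratedFDeriv ℝ (j + k + 1) Φ z‖ := by
          rw [Fin.prod_univ_castSucc]
          simp only [Fin.init, ha]
          ring

/-! ### The second-order Taylor bound -/

/-- **Second-order Taylor bound on `ℝ³`**: for `g ∈ C³(ℝ³; ℝ)` with `‖D³g‖ ≤ C` everywhere,
`|g(y) − g(0) − Dg(0)[y] − ½ D²g(0)[y, y]| ≤ C ‖y‖³` (Taylor–Lagrange along `t ↦ g(t y)`, Mathlib's
`taylor_mean_remainder_bound`; the sharp constant is `C/6`). [folklore] -/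
theorem norm_sub_taylor_two_le {g : EuclideanSpace ℝ (Fin 3) → ℝ} (hg : ContDiff ℝ 3 g) {C : ℝ}
    (hC : ∀ z, ‖iteratedFDeriv ℝ 3 g z‖ ≤ C) (y : EuclideanSpace ℝ (Fin 3)) :
    ‖g y - g 0 - iteratedFDeriv ℝ 1 g 0 (fun _ => y) - (1 / 2 : ℝ) * iteratedFDeriv ℝ 2 g 0 (fun _ => y)‖ ≤
      C * ‖y‖ ^ 3 := by
  set L : ℝ →L[ℝ] EuclideanSpace ℝ (Fin 3) := ContinuousLinearMap.toSpanSingleton ℝ y with hL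
  have hLt : ∀ t : ℝ, L t = t • y := fun t => by simp [hL]
  set φ : ℝ → ℝ := g ∘ L with hφ
  have hφ3 : ContDiff ℝ 3 φ := hg.comp L.contDiff
  have hC0 : 0 ≤ C := (norm_nonneg _).trans (hC 0)
  -- the iterated derivatives of `φ` are the iterated directional derivatives of `g` along `y`
  have hder : ∀ i : ℕ, (i : WithTop ℕ∞) ≤ 3 → ∀ t : ℝ,
      iteratedDeriv i φ t = iteratedFDeriv ℝ i g (t • y) (fun _ => y) := by
    intro i hi t
    rw [iteratedDeriv_eq_iteratedFDeriv, hφ, L.iteratedFDeriv_comp_right hg t hi,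
      ContinuousMultilinearMap.compContinuousLinearMap_apply, hLt]
    congr 1
    funext j
    rw [hLt, one_smul]
  have hwithin : ∀ i : ℕ, (i : WithTop ℕ∞) ≤ 3 → ∀ t ∈ Icc (0 : ℝ) 1,
      iteratedDerivWithin i φ (Icc 0 1) t = iteratedFDeriv ℝ i g (t • y) (fun _ => y) := by
    intro i hi t ht
    rw [iteratedDerivWithin_eq_iteratedDeriv (uniqueDiffOn_Icc zero_lt_one) (hφ3.of_le hi).contDiffAt ht,
      hder i hi t]
  -- the bound on the third derivative along the segment
  have hbound : ∀ t ∈ Icc (0 : ℝ) 1, ‖iteratedDerivWithin 3 φ (Icc 0 1) t‖ ≤ C * ‖y‖ ^ 3 := by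
    intro t ht
    rw [hwithin 3 le_rfl t ht]
    calc ‖iteratedFDeriv ℝ 3 g (t • y) (fun _ => y)‖ ≤ ‖iteratedFDeriv ℝ 3 g (t • y)‖ * ∏ _i : Fin 3, ‖y‖ :=
          ContinuousMultilinearMap.le_opNorm _ _
      _ ≤ C * ‖y‖ ^ 3 := by
          rw [Finset.prod_const, Finset.card_univ, Fintype.card_fin]
          exact mul_le_mul_of_nonneg_right (hC _) (by positivity)
  have hT := taylor_mean_remainder_bound (f := φ) (a := 0) (b := 1) (n := 2) zero_le_one hφ3.contDiffOn
    (right_mem_Icc.2 zero_le_one) hbound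
  -- the Taylor polynomial of `φ` at `0`, evaluated at `1`
  have h0 : (0 : ℝ) ∈ Icc (0 : ℝ) 1 := left_mem_Icc.2 zero_le_one
  have hpoly : taylorWithinEval φ 2 (Icc 0 1) 0 1 =
      g 0 + iteratedFDeriv ℝ 1 g 0 (fun _ => y) + (1 / 2 : ℝ) * iteratedFDeriv ℝ 2 g 0 (fun _ => y) := by
    rw [taylor_within_apply]
    simp only [Finset.sum_range_succ, Finset.sum_range_zero, zero_add, sub_zero, one_pow, mul_one,
      smul_eq_mul, Nat.factorial_zero, Nat.factorial_one, Nat.factorial_two, Nat.cast_one, inv_one, one_mul]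
    rw [iteratedDerivWithin_zero, hwithin 1 (by norm_num) 0 h0, hwithin 2 (by norm_num) 0 h0, zero_smul]
    simp only [hφ, Function.comp_apply, hLt, zero_smul, Nat.cast_ofNat, one_div]
  have hφ1 : φ 1 = g y := by simp only [hφ, Function.comp_apply, hLt, one_smul]
  rw [hpoly, hφ1] at hT
  calc ‖g y - g 0 - iteratedFDeriv ℝ 1 g 0 (fun _ => y) - (1 / 2 : ℝ) * iteratedFDeriv ℝ 2 g 0 (fun _ => y)‖
      = ‖g y - (g 0 + iteratedFDeriv ℝ 1 g 0 (fun _ => y) + (1 / 2 : ℝ) * iteratedFDeriv ℝ 2 g 0 (fun _ => y))‖ := by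
        congr 1; ring
    _ ≤ C * ‖y‖ ^ 3 * (1 - 0) ^ (2 + 1) / (2 : ℕ).factorial := hT
    _ ≤ C * ‖y‖ ^ 3 := by
        rw [Nat.factorial_two, sub_zero, one_pow, mul_one, Nat.cast_ofNat]
        have : 0 ≤ C * ‖y‖ ^ 3 := by positivity
        linarith

/-! ### The far Newton kernel: bounded derivatives, and the scale `c` -/

/-- **Every derivative of `Γ∞^{1,2}` is bounded on `ℝ³`** (compactness on `B̄(0,3)`, and the far bound
`‖DⁿΓ∞(z)‖ ≤ B‖z‖^{-(n+1)} ≤ B 3^{-(n+1)}` of `…ApexRegularityKernel`). [folklore] -/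
theorem exists_norm_iteratedFDeriv_newtonFar_le (n : ℕ) :
    ∃ B : ℝ, 0 ≤ B ∧ ∀ z : EuclideanSpace ℝ (Fin 3), ‖iteratedFDeriv ℝ n (newtonFar (1 : ℝ) 2) z‖ ≤ B := by
  obtain ⟨B, hB0, hB⟩ := exists_norm_iteratedFDeriv_newtonFar_le_far n
  have hΓ : ContDiff ℝ n (newtonFar (1 : ℝ) 2) := contDiff_newtonFar one_pos one_lt_two
  have hcont : Continuous (iteratedFDeriv ℝ n (newtonFar (1 : ℝ) 2)) := hΓ.continuous_iteratedFDeriv le_rfl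
  obtain ⟨B', hB'⟩ := (isCompact_closedBall (0 : EuclideanSpace ℝ (Fin 3)) 3).exists_bound_of_continuousOn
    hcont.continuousOn
  have hB'0 : 0 ≤ B' := (norm_nonneg _).trans (hB' 0 (mem_closedBall_self (by norm_num)))
  refine ⟨max B B', le_max_of_le_right hB'0, fun z => ?_⟩
  by_cases hz : 3 ≤ ‖z‖
  · have hz1 : (1 : ℝ) ≤ ‖z‖ ^ (n + 1) := one_le_pow₀ (by linarith)
    calc ‖iteratedFDeriv ℝ n (newtonFar 1 2) z‖ ≤ B * (‖z‖ ^ (n + 1))⁻¹ := hB z hz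
      _ ≤ B * 1 := mul_le_mul_of_nonneg_left (inv_le_one_of_one_le₀ hz1) hB0
      _ ≤ max B B' := by rw [mul_one]; exact le_max_left _ _
  · exact (hB' z (mem_closedBall_zero_iff.2 (not_le.1 hz).le)).trans (le_max_right _ _)

/-- **Scaling of the derivative bounds**: `‖DⁿΓ∞^{c,2c}(z)‖ ≤ c^{-(n+1)} B` whenever `‖DⁿΓ∞^{1,2}‖ ≤ B`
(`Γ∞^{c,2c} = c⁻¹Γ∞^{1,2}(c⁻¹·)`). [folklore] -/
theorem norm_iteratedFDeriv_newtonFar_scale_le {n : ℕ} {B : ℝ}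
    (hB : ∀ z : EuclideanSpace ℝ (Fin 3), ‖iteratedFDeriv ℝ n (newtonFar (1 : ℝ) 2) z‖ ≤ B)
    {c : ℝ} (hc : 0 < c) (z : EuclideanSpace ℝ (Fin 3)) :
    ‖iteratedFDeriv ℝ n (newtonFar (c * 1) (c * 2)) z‖ ≤ c⁻¹ ^ (n + 1) * B := by
  have hΓ : ContDiff ℝ n (newtonFar (1 : ℝ) 2) := contDiff_newtonFar one_pos one_lt_two
  rw [newtonFar_scale' hc]
  have h := PineauVicol2026.norm_iteratedFDeriv_unzoom_le hΓ hc 0 z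
  simp only [sub_zero] at h
  exact h.trans (mul_le_mul_of_nonneg_left (hB _) (by positivity))

/-- The far kernel at scale `c > 0` is smooth, with all derivatives bounded. [folklore] -/
theorem newtonFar_scale_smooth_bounded {c : ℝ} (hc : 0 < c) :
    ContDiff ℝ ∞ (newtonFar (c * 1) (c * 2)) ∧
      ∀ k : ℕ, ∃ B, ∀ z : EuclideanSpace ℝ (Fin 3), ‖iteratedFDeriv ℝ k (newtonFar (c * 1) (c * 2)) z‖ ≤ B := by
  refine ⟨contDiff_newtonFar (by linarith) (by linarith), fun k => ?_⟩
  obtain ⟨B, -, hB⟩ := exists_norm_iteratedFDeriv_newtonFar_le k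
  exact ⟨c⁻¹ ^ (k + 1) * B, fun z => norm_iteratedFDeriv_newtonFar_scale_le hB hc z⟩

/-! ### Registered sub-goal -/

/-- **Registered helper stub `stub_biotSavartKernelTools`** of `stub_biotSavartFarField` (crux
stmt-NavierStokesRegularity-11717, line `moment-conditioned-rellich`): the kernel-side tools of this file —
all-orders differentiation under the integral sign for bounded smooth kernels, the second-order Taylor bound,
and the smooth bounded far Newton kernel at scale `c`. [folklore] -/
theorem stub_biotSavartKernelTools :
    (∀ (n : ℕ) (Φ : EuclideanSpace ℝ (Fin 3) → ℝ) (F : EuclideanSpace ℝ (Fin 3) → EuclideanSpace ℝ (Fin 3)),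
      ContDiff ℝ (⊤ : ℕ∞) Φ → (∀ k : ℕ, ∃ B : ℝ, ∀ z, ‖iteratedFDeriv ℝ k Φ z‖ ≤ B) → Continuous F →
      Integrable F volume →
      ContDiff ℝ n (fun x => ∫ y, Φ (x - y) • F y) ∧
        ∀ (x : EuclideanSpace ℝ (Fin 3)) (m : Fin n → EuclideanSpace ℝ (Fin 3)),
          iteratedFDeriv ℝ n (fun x => ∫ y, Φ (x - y) • F y) x m = ∫ y, (iteratedFDeriv ℝ n Φ (x - y) m) • F y) ∧
    (∀ (g : EuclideanSpace ℝ (Fin 3) → ℝ) (C : ℝ), ContDiff ℝ 3 g → (∀ z, ‖iteratedFDeriv ℝ 3 g z‖ ≤ C) →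
      ∀ y : EuclideanSpace ℝ (Fin 3),
        ‖g y - g 0 - iteratedFDeriv ℝ 1 g 0 (fun _ => y) - (1 / 2 : ℝ) * iteratedFDeriv ℝ 2 g 0 (fun _ => y)‖ ≤
          C * ‖y‖ ^ 3) ∧
    (∀ (c : ℝ), 0 < c → ContDiff ℝ (⊤ : ℕ∞) (newtonFar (c * 1) (c * 2)) ∧
      ∀ k : ℕ, ∃ B : ℝ, ∀ z : EuclideanSpace ℝ (Fin 3), ‖iteratedFDeriv ℝ k (newtonFar (c * 1) (c * 2)) z‖ ≤ B) :=
  ⟨fun n _Φ _F hΦ hB hFc hFi => ⟨contDiff_integral_boundedKernel_smul n hΦ hB hFc hFi,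
      fun x m => iteratedFDeriv_integral_boundedKernel_smul_apply n hΦ hB hFc hFi x m⟩,
    fun _g _C hg hC y => norm_sub_taylor_two_le hg hC y,
    fun _c hc => newtonFar_scale_smooth_bounded hc⟩

end Summit.NavierStokesRegularity.NavierStokesRegularity.Theorems.RellichScarScarRigidity

end
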